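import Literature.Probability.FitznerVanDerHofstad2017.NobleBoundsNDispatchAll
import Literature.Probability.FitznerVanDerHofstad2017.NobleBoundsNEndDoublePrime
import Literature.Probability.FitznerVanDerHofstad2017.NobleBoundsNCoverDoublePrime
import HarnessLib

/-!
# Fitzner–van der Hofstad (2017), §6.1 (6.4) at `N = M + 2`: dispatch over all class pairs — terminal family `Ā''`

[FvdH17] = R. Fitzner, R. van der Hofstad, *Mean-field behavior for nearest-neighbor percolation in `d > 10`*,
Electron. J. Probab. **22** (2017), no. 43, arXiv:1506.07977v2; §6.1 (6.4) (p. 58), "Case `a = 0, b ≥ 2`" (p. 59), Prop. 5.5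
(5.34) (p. 53).

`NobleBoundsNDispatchAll` assembles the per-junction packages of an `N = M + 2` diagram into the class estimate `h2` and the
size-model inequality (5.34), with the LAST junction dispatched by `NobleBoundsNEndC1.nonempty_jPkg_end_starA` against the
App.-B-typed terminal table `starA Ā' (secEA Ā' 2)`.  This module is the same assembly with the terminal family
`Ā'' = blockAbar''` of `NobleBlocksDoublePrime` (row `(0,2)` repulsive): the target of the last junction `tgtLast''`, the
all-junction package family `nonempty_jPkg_all''` (first and middle junctions VERBATIM from the landed dispatch — their targets
`tgtAll`/`tgtJ` are built from `blockBFullpt'` and do not see `Ā` — and the last junction by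
`NobleBoundsNEndDoublePrime.nonempty_jPkg_end_starA''`), the class estimate
`prod_bondJ_mul_piPerc_jwCover_le_secStar_of_pairPackages''` (the landed `A`-generic chain inequality
`prod_bondJ_mul_piPerc_jwCover_le_chain_of_packages` at `A := starA Ā'' (secEA Ā'' 2)`) and (5.34)
`tsum_nobleXiT_le_secStar'_of_pairPackages''` (via `NobleBoundsNCoverDoublePrime.tsum_nobleXiT_le_secStar'_of_cover''`).
Conventions: `d`-generic; nothing is cited as a fact; additive (no existing declaration is changed).
-/

noncomputable section

open scoped ENNReal

namespace Literature.Probability.FitznerVanDerHofstad2017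

open Literature.Barriers.CriticalPhenomena Literature.Probability.Percolation
open Literature.Probability.LatticeModels Literature.Combinatorics.SimpleGraph _root_.SimpleGraph
open _root_.MeasureTheory
open Literature.Probability.FitznerVanDerHofstad2017.NobleBlocks
open Literature.Probability.FitznerVanDerHofstad2017.NobleBlocks.LenIdx
open Literature.Probability.FitznerVanDerHofstad2017.BlockSummation

variable {d : ℕ}

/-! ### B. The per-junction targets and the consumer's `hT` / `hTL` -/

section Targets

variable (L : Letters d) (M : ℕ) (x : Site d) (a : Fin (M + 2) → Fin 3 ⊕ Unit) (c : Fin 3 ⊕ Unit)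
  (b : Fin (M + 2) → Site d × Site d) (w t z : Fin (M + 2) → Site d) (κ : Fin (M + 2) → Fin d × Bool)


/-- **The target of the last junction**: `starA (Ā'') (secEA Ā'' 2)^{κ,a,c}(u,w,t,z) · starS (P^{E}) (c) (t − x, z − x)`
(the target of `NobleBoundsNEndC1.nonempty_jPkg_end_starA`).
[cite: FitznerVanDerHofstad2017, §6.1 (6.4) last factor (arXiv:1506.07977v2 p. 58); §5.1 (5.4) (p. 48)] -/
def tgtLast'' : ℝ≥0∞ :=
  starA (blockAbar'' L) (secEA (blockAbar'' L) 2) (κ (Fin.last (M + 1))) (a (Fin.last (M + 1))) c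
      (b (Fin.last (M + 1))).1 (w (Fin.last (M + 1))) (t (Fin.last (M + 1))) (z (Fin.last (M + 1))) *
    starS (blockPE L) c (t (Fin.last (M + 1)) - x) (z (Fin.last (M + 1)) - x)

end Targets

section Packages

variable (p : unitInterval) (M : ℕ) (x : Site d) (b : Fin (M + 2) → Site d × Site d) (w t z : Fin (M + 2) → Site d)
  (a : Fin (M + 2) → Fin 3 ⊕ Unit) (c : Fin 3 ⊕ Unit) (τ : Fin (M + 1) → Bool × Fin 3)

/-- **`pkg` from per-pair packages.**  For a direction vector `κ` of the pivotal bonds and an admissible variant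
`τ`, packages at EVERY junction for the targets `jTarget M (tgtAll (Letters.perc d p) …) (tgtLast'' (Letters.perc d p) …) τ`, given packages for:
the first junction with a regular pair (`hFR`, target with the start factor `P^{S,a_0}(u_0,w_0)`), a middle
junction with a regular pair (`hMR`), and a middle junction over a closed level with a regular upper class
(`hML`); §E the size-model inequality (5.34) at `N = M + 2` from the same three families
(`tsum_nobleXiT_le_secStar'_of_pairPackages''`, via `NobleBoundsNCoverPrime`).  Discharged here: regular/`★` pairs (`nonempty_jPkg_first_starU`, `nonempty_jPkg_mid_starU`; the kind bit
is `false` by admissibility), `★★` pairs (`nonempty_jPkg_mid_starStar` on the sections `z_k = w_k`,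
`w_{k+1} = u_k`, empty off them: `nonempty_jPkg_starStar_of_ne`), a closed FIRST level (empty:
`nonempty_jPkg_of_closed_zero`), the last junction (`nonempty_jPkg_end_starA`).
[cite: FitznerVanDerHofstad2017, §6.1 (6.4) and "Case b = 0 / 1 / ≥ 2" (arXiv:1506.07977v2 pp. 58–59); §5.1 (5.4) (p. 48); (4.57)–(4.64) (pp. 41–42)] -/
theorem nonempty_jPkg_all'' (κ : Fin (M + 2) → Fin d × Bool) (hκ : ∀ i, (b i).2 = (b i).1 + stepVec (κ i))
    (hτ : AdmT M a τ)
    (hFR : ∀ a₀ a' : Fin 3, a (0 : Fin (M + 1)).castSucc = Sum.inl a₀ → a (0 : Fin (M + 1)).succ = Sum.inl a' →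
      Nonempty (JPkg p (jctx M x b w t z a τ (0 : Fin (M + 1)).castSucc) (JFacts M x b w t z a c τ)
        (blockPS (Letters.perc d p) a₀ (b (0 : Fin (M + 1)).castSucc).1 (w (0 : Fin (M + 1)).castSucc) *
          tgtReg (Letters.perc d p) (κ (0 : Fin (M + 1)).castSucc) a₀ a' (b (0 : Fin (M + 1)).castSucc).1
            (w (0 : Fin (M + 1)).castSucc) (t (0 : Fin (M + 1)).castSucc) (z (0 : Fin (M + 1)).castSucc)
            (w (0 : Fin (M + 1)).succ) (b (0 : Fin (M + 1)).succ).1 (τ 0))))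
    (hMR : ∀ i i₀ : Fin (M + 1), i₀.succ = i.castSucc → ∀ a₀ a' : Fin 3, a i.castSucc = Sum.inl a₀ →
      a i.succ = Sum.inl a' →
      Nonempty (JPkg p (jctx M x b w t z a τ i.castSucc) (JFacts M x b w t z a c τ)
        (tgtReg (Letters.perc d p) (κ i.castSucc) a₀ a' (b i.castSucc).1 (w i.castSucc) (t i.castSucc) (z i.castSucc) (w i.succ)
          (b i.succ).1 (τ i))))
    (hML : ∀ i i₀ : Fin (M + 1), i₀.succ = i.castSucc → ∀ (u₀ : Unit) (a' : Fin 3), a i.castSucc = Sum.inr u₀ →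
      a i.succ = Sum.inl a' →
      Nonempty (JPkg p (jctx M x b w t z a τ i.castSucc) (JFacts M x b w t z a c τ)
        (tgtStarL (Letters.perc d p) (κ i.castSucc) a' (b i.castSucc).1 (w i.castSucc) (t i.castSucc) (z i.castSucc) (w i.succ)
          (b i.succ).1 (τ i)))) :
    ∀ k, Nonempty (JPkg p (jctx M x b w t z a τ k) (JFacts M x b w t z a c τ)
      (jTarget M (tgtAll (Letters.perc d p) M a b w t z κ) (tgtLast'' (Letters.perc d p) M x a c b w t z κ) τ k)) := by
  intro k
  induction k using Fin.lastCases with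
  | last =>
      simp only [jTarget, Fin.lastCases_last]
      exact nonempty_jPkg_end_starA'' p M x b w t z a c τ (κ _) (hκ _)
  | cast i =>
      simp only [jTarget, Fin.lastCases_castSucc]
      -- the kind bit of a level below a closed one is `false` (admissibility)
      have hσ : ∀ u₁ : Unit, a i.succ = Sum.inr u₁ → (τ i).1 = false := fun u₁ h => hτ i (by rw [h]; rfl)
      rcases Fin.eq_zero_or_eq_succ i with rfl | ⟨j, rfl⟩
      · -- the FIRST junction
        rw [tgtAll, if_pos rfl]
        rcases ha : a (0 : Fin (M + 1)).castSucc with a₀ | u₀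
        · rcases ha' : a (0 : Fin (M + 1)).succ with a' | u₁
          · rw [starS_inl, tgtJ_inl_inl]
            exact hFR a₀ a' ha ha'
          · rw [starS_inl, tgtJ_inl_inr]
            exact nonempty_jPkg_first_starU p M x b w t z a c τ (κ _) (hκ _) a₀ ha ha' (hσ u₁ ha')
        · exact nonempty_jPkg_of_closed_zero p M x b w t z a c τ ha _ _
      · -- a MIDDLE junction `k = j + 1`
        rw [tgtAll, if_neg (Fin.succ_ne_zero j), one_mul]
        have hk : (j.castSucc).succ = (j.succ).castSucc := Fin.succ_castSucc j
        rcases ha : a j.succ.castSucc with a₀ | u₀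
        · rcases ha' : a j.succ.succ with a' | u₁
          · rw [tgtJ_inl_inl]
            exact hMR _ _ hk a₀ a' ha ha'
          · rw [tgtJ_inl_inr]
            exact nonempty_jPkg_mid_starU p M x b w t z a c τ _ _ hk (κ _) (hκ _) a₀ ha ha' (hσ u₁ ha')
        · rcases ha' : a j.succ.succ with a' | u₁
          · rw [tgtJ_inr_inl]
            exact hML _ _ hk u₀ a' ha ha'
          · rw [tgtJ_inr_inr]
            by_cases hs : z j.succ.castSucc = w j.succ.castSucc ∧ w j.succ.succ = (b j.succ.castSucc).1
            · exact nonempty_jPkg_mid_starStar p M x b w t z a c τ _ _ hk (κ _) (hκ _) ha ha' hs.1 hs.2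
            · exact nonempty_jPkg_starStar_of_ne p M x b w t z a c τ _ _ hk ha ha' (not_and_or.mp hs) _

end Packages

/-! ### D. The class estimate `h2` over `secStarBpt (blockBFullpt' (Letters.perc d p) X) 2 0` from per-pair packages -/

section ClassEstimate

variable (p : unitInterval) (M : ℕ) (x : Site d)


/-- **THE CLASS ESTIMATE `h2` FROM PER-PAIR JUNCTION PACKAGES** (the `h2` hypothesis of
`NobleBoundsNAssemblyStar.tsum_nobleXiT_le_secStar_of_cover`, over the PRIMED pointwise middle block with four-line
family `X`): at `(a, c, b⃗, w⃗, t⃗, z⃗)`, packages for the first regular pair, the middle regular pairs, the middle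
lower-`★` pairs and the `★★` pairs on their sections — for every direction vector and admissible variant — give
`(∏_i J(b_i)) · ℙ^{⊗(M+3)}(E ∩ C(a,c)) ≤ Σ_κ 𝟙{b = (u, u + e_κ)} · starS(P^S)^{a_0}(u_0,w_0) ·
chainTail (secStarBpt (B'_pt) 2 0) (starA Ā'' (secEA Ā'' 2)) (starS P^E)`.
[cite: FitznerVanDerHofstad2017, §6.1 (6.4) pp. 58–59, §6.2.1 (6.48)–(6.51) pp. 65–67, §5.1 (5.4) p. 48, App. B pp. 74–78 (arXiv:1506.07977v2)] -/
theorem prod_bondJ_mul_piPerc_jwCover_le_secStar_of_pairPackages'' (X : DirBlockFamilyPt d)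
    (a : Fin (M + 2) → Fin 3 ⊕ Unit) (c : Fin 3 ⊕ Unit) (b : Fin (M + 2) → Site d × Site d)
    (w t z : Fin (M + 2) → Site d)
    (hFR : ∀ κ : Fin (M + 2) → Fin d × Bool, (∀ i, (b i).2 = (b i).1 + stepVec (κ i)) →
      ∀ τ : Fin (M + 1) → Bool × Fin 3, AdmT M a τ →
      ∀ a₀ a' : Fin 3, a (0 : Fin (M + 1)).castSucc = Sum.inl a₀ → a (0 : Fin (M + 1)).succ = Sum.inl a' →
      Nonempty (JPkg p (jctx M x b w t z a τ (0 : Fin (M + 1)).castSucc) (JFacts M x b w t z a c τ)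
        (blockPS (Letters.perc d p) a₀ (b (0 : Fin (M + 1)).castSucc).1 (w (0 : Fin (M + 1)).castSucc) *
          tgtReg (Letters.perc d p) (κ (0 : Fin (M + 1)).castSucc) a₀ a' (b (0 : Fin (M + 1)).castSucc).1
            (w (0 : Fin (M + 1)).castSucc) (t (0 : Fin (M + 1)).castSucc) (z (0 : Fin (M + 1)).castSucc)
            (w (0 : Fin (M + 1)).succ) (b (0 : Fin (M + 1)).succ).1 (τ 0))))
    (hMR : ∀ κ : Fin (M + 2) → Fin d × Bool, (∀ i, (b i).2 = (b i).1 + stepVec (κ i)) →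
      ∀ τ : Fin (M + 1) → Bool × Fin 3, AdmT M a τ →
      ∀ i i₀ : Fin (M + 1), i₀.succ = i.castSucc → ∀ a₀ a' : Fin 3, a i.castSucc = Sum.inl a₀ →
      a i.succ = Sum.inl a' →
      Nonempty (JPkg p (jctx M x b w t z a τ i.castSucc) (JFacts M x b w t z a c τ)
        (tgtReg (Letters.perc d p) (κ i.castSucc) a₀ a' (b i.castSucc).1 (w i.castSucc) (t i.castSucc) (z i.castSucc) (w i.succ)
          (b i.succ).1 (τ i))))
    (hML : ∀ κ : Fin (M + 2) → Fin d × Bool, (∀ i, (b i).2 = (b i).1 + stepVec (κ i)) →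
      ∀ τ : Fin (M + 1) → Bool × Fin 3, AdmT M a τ →
      ∀ i i₀ : Fin (M + 1), i₀.succ = i.castSucc → ∀ (u₀ : Unit) (a' : Fin 3), a i.castSucc = Sum.inr u₀ →
      a i.succ = Sum.inl a' →
      Nonempty (JPkg p (jctx M x b w t z a τ i.castSucc) (JFacts M x b w t z a c τ)
        (tgtStarL (Letters.perc d p) (κ i.castSucc) a' (b i.castSucc).1 (w i.castSucc) (t i.castSucc) (z i.castSucc) (w i.succ)
          (b i.succ).1 (τ i)))) :
    (∏ i, ENNReal.ofReal (bondJ d p ((b i).2 - (b i).1))) *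
        piPerc d p (M + 3) (jwCoverE M x b w t z ∩ jwCoverC M x b w t z a c) ≤
      ∑ κ : Fin (M + 2) → Fin d × Bool, dirInd stepVec κ b *
        (starS (blockPS (Letters.perc d p)) (a 0) (b 0).1 (w 0) *
          chainTail (secStarBpt (blockBFullpt' (Letters.perc d p) X) 2 0) (starA (blockAbar'' (Letters.perc d p)) (secEA (blockAbar'' (Letters.perc d p)) 2))
            (starS (blockPE (Letters.perc d p))) x (M + 1) κ a c b w t z) :=
  prod_bondJ_mul_piPerc_jwCover_le_chain_of_packages p M x (starS (blockPS (Letters.perc d p))) (secStarBpt (blockBFullpt' (Letters.perc d p) X) 2 0)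
    (starA (blockAbar'' (Letters.perc d p)) (secEA (blockAbar'' (Letters.perc d p)) 2)) (starS (blockPE (Letters.perc d p))) a c b w t z (tgtAll (Letters.perc d p) M a b w t z)
    (tgtLast'' (Letters.perc d p) M x a c b w t z)
    (fun κ hκ τ hτ => nonempty_jPkg_all'' p M x b w t z a c τ κ hκ hτ (hFR κ hκ τ hτ) (hMR κ hκ τ hτ) (hML κ hκ τ hτ))
    (fun κ _ i => sum_filter_tgtAll_le (Letters.perc d p) M a b w t z κ X i) fun _ _ => le_rfl

end ClassEstimate

/-! ### E. (5.34) at `N = M + 2` from per-pair packages -/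

section SizeModel

open scoped Matrix
open Literature.Probability.FitznerVanDerHofstad2017.BlockSummation

variable (p : unitInterval) (M : ℕ)

/-- **(5.34) AT `N = M + 2` FROM PER-PAIR JUNCTION PACKAGES** (section choice of `NobleBoundsNCoverPrime`): if at
every `(x, a, c, b⃗, w⃗, t⃗, z⃗)` the three per-pair package families of
`prod_bondJ_mul_piPerc_jwCover_le_secStar_of_pairPackages''` are available (first regular pair, middle regular pairs,
middle lower-`★` pairs; the `★`-upper and `★★` pairs are discharged in this file), then for every four-line remainder
family `X` summing to a translation-invariant `X₂`,
`Σ_x Ξ̂^{(M+2)}(x) ≤ (P^S)ᵗ · B_sec^{M+1} · Ā_sec · P^E` over `Fin 3 ⊕ Unit` — `NobleBoundsNCoverPrime.tsum_nobleXiT_le_secStar'_of_cover`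
with `hC`, `h1` the cover of `NobleJointNLevel` (`jwCoverE_subset_iUnion_jwCoverC`, `nobleXiT_succ_succ_le_jwCoverE`)
and `h2` the class estimate of §D.
[cite: FitznerVanDerHofstad2017, Prop. 5.5 (5.34) (arXiv:1506.07977v2 p. 53); §5.1 (5.4) (p. 48) and "Elements of the bounds" (p. 49); §6.1 (6.4) (pp. 58–59); Lemma 6.1, §6.2.1 (6.48)–(6.51) (pp. 65–67)] -/
theorem tsum_nobleXiT_le_secStar'_of_pairPackages'' (X : DirBlockFamilyPt d) (X₂ : DirBlockFamily d)
    (hXsum : ∀ κ a a' u w w' u', ∑' t, ∑' z, X κ a a' u w t z w' u' = X₂ κ a a' u w w' u')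
    (hX₂ti : ∀ ι a b, IsTransInv (X₂ ι a b)) (hXti : ∀ κ a a', IsTransInv₆ (X κ a a'))
    (hFR : ∀ (x : Site d) (a : Fin (M + 2) → Fin 3 ⊕ Unit) (c : Fin 3 ⊕ Unit) (b : Fin (M + 2) → Site d × Site d)
      (w t z : Fin (M + 2) → Site d),
      ∀ κ : Fin (M + 2) → Fin d × Bool, (∀ i, (b i).2 = (b i).1 + stepVec (κ i)) →
      ∀ τ : Fin (M + 1) → Bool × Fin 3, AdmT M a τ →
      ∀ a₀ a' : Fin 3, a (0 : Fin (M + 1)).castSucc = Sum.inl a₀ → a (0 : Fin (M + 1)).succ = Sum.inl a' →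
      Nonempty (JPkg p (jctx M x b w t z a τ (0 : Fin (M + 1)).castSucc) (JFacts M x b w t z a c τ)
        (blockPS (Letters.perc d p) a₀ (b (0 : Fin (M + 1)).castSucc).1 (w (0 : Fin (M + 1)).castSucc) *
          tgtReg (Letters.perc d p) (κ (0 : Fin (M + 1)).castSucc) a₀ a' (b (0 : Fin (M + 1)).castSucc).1
            (w (0 : Fin (M + 1)).castSucc) (t (0 : Fin (M + 1)).castSucc) (z (0 : Fin (M + 1)).castSucc)
            (w (0 : Fin (M + 1)).succ) (b (0 : Fin (M + 1)).succ).1 (τ 0))))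
    (hMR : ∀ (x : Site d) (a : Fin (M + 2) → Fin 3 ⊕ Unit) (c : Fin 3 ⊕ Unit) (b : Fin (M + 2) → Site d × Site d)
      (w t z : Fin (M + 2) → Site d),
      ∀ κ : Fin (M + 2) → Fin d × Bool, (∀ i, (b i).2 = (b i).1 + stepVec (κ i)) →
      ∀ τ : Fin (M + 1) → Bool × Fin 3, AdmT M a τ →
      ∀ i i₀ : Fin (M + 1), i₀.succ = i.castSucc → ∀ a₀ a' : Fin 3, a i.castSucc = Sum.inl a₀ →
      a i.succ = Sum.inl a' →
      Nonempty (JPkg p (jctx M x b w t z a τ i.castSucc) (JFacts M x b w t z a c τ)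
        (tgtReg (Letters.perc d p) (κ i.castSucc) a₀ a' (b i.castSucc).1 (w i.castSucc) (t i.castSucc) (z i.castSucc) (w i.succ)
          (b i.succ).1 (τ i))))
    (hML : ∀ (x : Site d) (a : Fin (M + 2) → Fin 3 ⊕ Unit) (c : Fin 3 ⊕ Unit) (b : Fin (M + 2) → Site d × Site d)
      (w t z : Fin (M + 2) → Site d),
      ∀ κ : Fin (M + 2) → Fin d × Bool, (∀ i, (b i).2 = (b i).1 + stepVec (κ i)) →
      ∀ τ : Fin (M + 1) → Bool × Fin 3, AdmT M a τ →
      ∀ i i₀ : Fin (M + 1), i₀.succ = i.castSucc → ∀ (u₀ : Unit) (a' : Fin 3), a i.castSucc = Sum.inr u₀ →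
      a i.succ = Sum.inl a' →
      Nonempty (JPkg p (jctx M x b w t z a τ i.castSucc) (JFacts M x b w t z a c τ)
        (tgtStarL (Letters.perc d p) (κ i.castSucc) a' (b i.castSucc).1 (w i.castSucc) (t i.castSucc) (z i.castSucc) (w i.succ)
          (b i.succ).1 (τ i)))) :
    ∑' x, nobleXiT d p (M + 2) x ≤
      vecP (starS (blockPS (Letters.perc d p))) ᵥ*
        matB (starB (blockBFull' (Letters.perc d p) X₂) (secEc (blockBFullpt' (Letters.perc d p) X) 0)
          (secEo (blockBFullpt' (Letters.perc d p) X) 2) (secEoc (blockBFullpt' (Letters.perc d p) X) 2 0)) ^ (M + 1) ᵥ*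
          matAbar (starA (blockAbar'' (Letters.perc d p)) (secEA (blockAbar'' (Letters.perc d p)) 2)) ⬝ᵥ
        vecP (starS (blockPE (Letters.perc d p))) :=
  tsum_nobleXiT_le_secStar'_of_cover'' p (M + 1) X X₂ hXsum hX₂ti hXti (fun x b w t z => jwCoverE M x b w t z)
    (fun x b w t z a c => jwCoverC M x b w t z a c) (fun x => jwCoverE_subset_iUnion_jwCoverC M x)
    (fun x => nobleXiT_succ_succ_le_jwCoverE p M x)
    fun x a c b w t z => prod_bondJ_mul_piPerc_jwCover_le_secStar_of_pairPackages'' p M x X a c b w t z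
      (hFR x a c b w t z) (hMR x a c b w t z) (hML x a c b w t z)

end SizeModel

end Literature.Probability.FitznerVanDerHofstad2017

end
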